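import Mathlib.RepresentationTheory.Basic
import HarnessLib

/-!
# Semilinearly isomorphic representations (`τ`-twists): the predicate and its calculus

Topic `Literature/RepresentationTheory/Semisimple`; namespace `Literature.RepresentationTheory.Semisimple`.  ONE definition
(`AreSemilinearIso τ ρ ρ'`, a `Prop`-valued predicate with parameters — no named fact, debt 0) and its elementary calculus; no `sorry`.

For a ring homomorphism `τ : k →+* k'` of coefficient fields, representations `ρ` of `G` on a `k`-space `V` and `ρ'` of `G` on a
`k'`-space `V'` are **`τ`-semilinearly isomorphic** when there is a BIJECTIVE `τ`-semilinear map `f : V →ₛₗ[τ] V'` with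
`f (ρ g v) = ρ' g (f v)`; for `k = k' = ℂ` and `τ = σ ∈ Aut(ℂ)` this says `ρ' ≅ ρ^σ`, the GALOIS TWIST (conjugate) of `ρ` — the
representation «`σ ⊗_{ℂ,σ} ρ`» of [BushnellHenniart2006]-style local arguments and of [Liu2021, Thm. 4.18 (3)] (tree row III-11
`Thm418Data.EpsRigidUnderGaloisTwist`, typed verbatim as `∃ f : ω_i →ₛₗ[σ] ω_j, Bijective f ∧ ∀ g w, f (ρ_i g w) = ρ_j g (f w)`), for
`τ = id` it is the tree's `Liu2021.AreIsomorphicRep` / Mathlib's `Representation.Equiv` up to packaging.  We never form the twisted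
module; the predicate is the whole interface.

* `AreSemilinearIso τ ρ ρ'` (definition); `of_linearEquiv` (`τ = id`);
* composition with LINEAR equivariant equivalences on either side (`linearEquiv_trans`, `trans_linearEquiv`);
* inversion along a two-sided inverse `τ'` of `τ` (`symm`);
* **two-out-of-three** (`exists_linearEquiv_of_two`): two `τ`-semilinear isomorphisms `ρ → ρ₁`, `ρ → ρ₂` out of the SAME `ρ`
  (`τ` surjective) give a LINEAR equivariant `ρ₁ ≃ ρ₂` — the step «`X^σ ≅ X₁` and `X^σ ≅ X₂` force `X₁ ≅ X₂`» by which a Galois-twist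
  computation is fed into a linear rigidity statement ([Liu2021] App. D Lem. D.1 (3) in the consumer).

## References
* [BourbakiAlgebreVIII2012] N. Bourbaki, *Algèbre VIII*, §4 n°3 (semilinear isomorphisms; the calculus is the same as the linear one).
* [Liu2021] Y. Liu, Camb. J. Math. 9 (2021), Thm. 4.18 (3) with proof l. 2272–2289; App. D Lem. D.1 (3) (the consumer).
-/

noncomputable section

namespace Literature.RepresentationTheory.Semisimple

variable {k k' k'' : Type*} [Field k] [Field k'] [Field k'']
variable {G : Type*} [Monoid G]
variable {V V₀ V' V'' V₁ V₂ : Type*} [AddCommGroup V] [Module k V] [AddCommGroup V₀] [Module k V₀]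
  [AddCommGroup V'] [Module k' V'] [AddCommGroup V''] [Module k' V''] [AddCommGroup V₁] [Module k' V₁]
  [AddCommGroup V₂] [Module k' V₂]

/-- **`ρ` and `ρ'` are `τ`-semilinearly isomorphic** (`ρ' ≅ ρ^τ`, the `τ`-twist of `ρ`): a bijective `τ`-semilinear
`G`-equivariant map `V → V'` exists.  For `τ = σ ∈ Aut(ℂ)`: `ρ'` is the Galois conjugate `ρ^σ`. [cite: BourbakiAlgebreVIII2012, §4 n°3] -/
def AreSemilinearIso (τ : k →+* k') (ρ : Representation k G V) (ρ' : Representation k' G V') : Prop :=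
  ∃ f : V →ₛₗ[τ] V', Function.Bijective f ∧ ∀ (g : G) (v : V), f (ρ g v) = ρ' g (f v)

namespace AreSemilinearIso

/-- A linear equivariant equivalence is an `id`-semilinear isomorphism. [cite: BourbakiAlgebreVIII2012, §4 n°3] -/
theorem of_linearEquiv {ρ : Representation k G V} {ρ₀ : Representation k G V₀} (e : V ≃ₗ[k] V₀)
    (he : ∀ (g : G) (v : V), e (ρ g v) = ρ₀ g (e v)) : AreSemilinearIso (RingHom.id k) ρ ρ₀ :=
  ⟨e.toLinearMap, e.bijective, he⟩

/-- Post-composition with a LINEAR equivariant equivalence. [cite: BourbakiAlgebreVIII2012, §4 n°3] -/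
theorem trans_linearEquiv {τ : k →+* k'} {ρ : Representation k G V} {ρ' : Representation k' G V'}
    {ρ'' : Representation k' G V''} (h : AreSemilinearIso τ ρ ρ') (e : V' ≃ₗ[k'] V'')
    (he : ∀ (g : G) (v : V'), e (ρ' g v) = ρ'' g (e v)) : AreSemilinearIso τ ρ ρ'' := by
  obtain ⟨f, hf, hfe⟩ := h
  refine ⟨e.toLinearMap.comp f, ?_, fun g v => ?_⟩
  · simpa only [LinearMap.coe_comp, LinearEquiv.coe_coe] using e.bijective.comp hf
  · simp only [LinearMap.coe_comp, LinearEquiv.coe_coe, Function.comp_apply, hfe, he]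

/-- Pre-composition with a LINEAR equivariant equivalence. [cite: BourbakiAlgebreVIII2012, §4 n°3] -/
theorem linearEquiv_trans {τ : k →+* k'} {ρ₀ : Representation k G V₀} {ρ : Representation k G V}
    {ρ' : Representation k' G V'} (e : V₀ ≃ₗ[k] V) (he : ∀ (g : G) (v : V₀), e (ρ₀ g v) = ρ g (e v))
    (h : AreSemilinearIso τ ρ ρ') : AreSemilinearIso τ ρ₀ ρ' := by
  obtain ⟨f, hf, hfe⟩ := h
  refine ⟨f.comp e.toLinearMap, ?_, fun g v => ?_⟩
  · simpa only [LinearMap.coe_comp, LinearEquiv.coe_coe] using hf.comp e.bijective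
  · simp only [LinearMap.coe_comp, LinearEquiv.coe_coe, Function.comp_apply, he, hfe]

/-- **Inversion**: along a right inverse `τ'` of `τ` (`τ ∘ τ' = id`; e.g. `σ.symm` for an automorphism `σ`), a `τ`-semilinear
isomorphism `ρ → ρ'` inverts to a `τ'`-semilinear isomorphism `ρ' → ρ`. [cite: BourbakiAlgebreVIII2012, §4 n°3] -/
theorem symm {τ : k →+* k'} {τ' : k' →+* k} (hττ' : ∀ c, τ (τ' c) = c)
    {ρ : Representation k G V} {ρ' : Representation k' G V'} (h : AreSemilinearIso τ ρ ρ') : AreSemilinearIso τ' ρ' ρ := by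
  obtain ⟨f, hf, hfe⟩ := h
  set E : V ≃ V' := Equiv.ofBijective f hf with hE
  have hEf : ∀ v, E v = f v := fun v => rfl
  refine ⟨{ toFun := E.symm
            map_add' := fun x y => ?_
            map_smul' := fun c x => ?_ }, ?_, fun g y => ?_⟩
  · rw [Equiv.symm_apply_eq, hEf, map_add, ← hEf, ← hEf, E.apply_symm_apply, E.apply_symm_apply]
  · rw [Equiv.symm_apply_eq, hEf, LinearMap.map_smulₛₗ, hττ', ← hEf, E.apply_symm_apply]
  · exact E.symm.bijective
  · show E.symm (ρ' g y) = ρ g (E.symm y)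
    rw [Equiv.symm_apply_eq, hEf, hfe, ← hEf, E.apply_symm_apply]

/-- **Two-out-of-three**: `τ`-semilinear isomorphisms `ρ → ρ₁` and `ρ → ρ₂` out of the same `ρ`, with `τ` surjective, give a LINEAR
equivariant equivalence `ρ₁ ≃ ρ₂` (`f₂ ∘ f₁⁻¹` is `k'`-linear because every scalar of `k'` is a `τ c`).  This is how a Galois-twist
computation («`X^σ ≅ X₁`») meets a linear rigidity statement. [cite: BourbakiAlgebreVIII2012, §4 n°3] -/
theorem exists_linearEquiv_of_two {τ : k →+* k'} (hτ : Function.Surjective τ) {ρ : Representation k G V}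
    {ρ₁ : Representation k' G V₁} {ρ₂ : Representation k' G V₂} (h₁ : AreSemilinearIso τ ρ ρ₁) (h₂ : AreSemilinearIso τ ρ ρ₂) :
    ∃ e : V₁ ≃ₗ[k'] V₂, ∀ (g : G) (v : V₁), e (ρ₁ g v) = ρ₂ g (e v) := by
  obtain ⟨f₁, hf₁, hfe₁⟩ := h₁
  obtain ⟨f₂, hf₂, hfe₂⟩ := h₂
  set E : V ≃ V₁ := Equiv.ofBijective f₁ hf₁ with hE
  have hEf : ∀ v, E v = f₁ v := fun v => rfl
  -- the candidate `f₂ ∘ f₁⁻¹`, linear over `k'`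
  let L : V₁ →ₗ[k'] V₂ :=
    { toFun := fun y => f₂ (E.symm y)
      map_add' := fun x y => by
        have hx : E.symm (x + y) = E.symm x + E.symm y := by
          rw [Equiv.symm_apply_eq, hEf, map_add, ← hEf, ← hEf, E.apply_symm_apply, E.apply_symm_apply]
        rw [hx, map_add]
      map_smul' := fun c' y => by
        obtain ⟨c, rfl⟩ := hτ c'
        have hc : E.symm (τ c • y) = c • E.symm y := by
          rw [Equiv.symm_apply_eq, hEf, LinearMap.map_smulₛₗ, ← hEf, E.apply_symm_apply]
        rw [RingHom.id_apply, hc, LinearMap.map_smulₛₗ] }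
  have hL : Function.Bijective L := hf₂.comp E.symm.bijective
  refine ⟨LinearEquiv.ofBijective L hL, fun g y => ?_⟩
  show f₂ (E.symm (ρ₁ g y)) = ρ₂ g (f₂ (E.symm y))
  have hy : E.symm (ρ₁ g y) = ρ g (E.symm y) := by
    rw [Equiv.symm_apply_eq, hEf, hfe₁, ← hEf, E.apply_symm_apply]
  rw [hy, hfe₂]

end AreSemilinearIso

end Literature.RepresentationTheory.Semisimple

end
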